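import Mathlib.MeasureTheory.Integral.IntervalIntegral.Basic
import Mathlib.MeasureTheory.Integral.Prod
import Literature.Analysis.FunctionSpaces.KantorovichLogDistance
import HarnessLib

/-!
# Seis 2022, §2.2: the time chain for the Kantorovich distance along a weak solution

Analysis/FluidPDE proof-support file (everything proved; serves the discharge of the named facts
`Literature.Analysis.FluidPDE.Seis2022_rmk1_L2` / `Seis2022_thm2_L2`, `SeisDissipationRateBound`).
It contains the **time bookkeeping** of the proof of Seis 2022, Thm. 2 (§2.2, "Integrating (4)
over `[tⁿ, tⁿ⁺¹]` … Summing over `n`"), in the form appropriate for merely measurable-in-time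
weak solutions, and is independent of the PDE:

* `krLogDist_sub_le_of_sliceBound` — **one increment**: if two mean-zero densities `ρₛ, ρₜ` on
  `T^d` differ by a time integral of a flux, `ρₜ - ρₛ = ∫_{(s,t]} fl(σ, ·) dσ`, and every optimal
  potential `ζ` of `ρₛ` satisfies the slice bound `-∫ ζ fl(σ) ≤ m(σ)` for a.e. `σ ∈ (s,t]`, then
  `krLogDist δ ρₛ - krLogDist δ ρₜ ≤ ∫_{(s,t]} m` (an optimal potential exists by Arzelà–Ascoli,
  `krLogDist δ ρₜ ≥ ∫ ρₜ ζ`, Fubini);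
* `krLogDist_le_krLogDist_add_of_abs_sub_le` — the dual distance is `log(1+1/(2δ))`-Lipschitz for
  the sup norm (used to compare time `0` with a nearby good time);
* `exists_chain_mem` — **good partitions**: a set of full measure in `(0,T)` contains, between any
  two of its points, chains with mesh `≤ h`;
* `sub_le_integral_add_of_chain` — **telescoping** of increments
  `Φ s - Φ t ≤ ∫_{(s,t]} m + c (t-s)` along such a chain.

## References

* C. Seis, Comm. Math. Phys. 399 (2023) = arXiv:2003.08794, §2.2, proof of Thm. 2 (p. 8). [`Seis2022`]
-/

noncomputable section

open MeasureTheory Set Filter Metric Function Topology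
open scoped ENNReal NNReal Topology
open Literature.Analysis.FunctionSpaces Literature.Analysis.FunctionSpaces.Torus

namespace Literature.Analysis.FluidPDE

variable {d : Type*} [Fintype d]

/-! ## One increment from a slice bound -/

/-- **One increment of the Kantorovich distance from a slice bound.** Let `δ > 0`, `ρₛ, ρₜ`
mean-zero integrable densities with `ρₜ x - ρₛ x = ∫_{(s,t]} fl(σ, x) dσ` for all `x`, the flux
`fl` jointly measurable with `‖fl(σ, x)‖ ≤ bound(σ) ∈ L¹(s,t]`, and suppose that every normalised
optimal potential `ζ` of `ρₛ` satisfies `-∫ ζ fl(σ) ≤ m(σ)` for a.e. `σ ∈ (s,t]`, `m ∈ L¹(s,t]`.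
Then `krLogDist δ ρₛ - krLogDist δ ρₜ ≤ ∫_{(s,t]} m` (Seis 2022, §2.2: Lemma 3 integrated in
time, weak form). [cite: Seis2022, proof of Thm 2, §2.2 (p. 8)] -/
theorem krLogDist_sub_le_of_sliceBound {δ : ℝ} (hδ : 0 < δ) {ρs ρt : UnitAddTorus d → ℝ}
    (hρs : Integrable ρs volume) (hs0 : ∫ x, ρs x = 0) (hρt : Integrable ρt volume) (ht0 : ∫ x, ρt x = 0)
    {s t : ℝ} {fl : ℝ → UnitAddTorus d → ℝ} {bound m : ℝ → ℝ}
    (hprim : ∀ x, ρt x - ρs x = ∫ σ in Ioc s t, fl σ x)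
    (hflm : AEStronglyMeasurable (uncurry fl) (((volume : Measure ℝ).restrict (Ioc s t)).prod volume))
    (hbd : ∀ᵐ σ ∂((volume : Measure ℝ).restrict (Ioc s t)), ∀ x, ‖fl σ x‖ ≤ bound σ)
    (hbi : IntegrableOn bound (Ioc s t)) (hmi : IntegrableOn m (Ioc s t))
    (hslice : ∀ᵐ σ ∂((volume : Measure ℝ).restrict (Ioc s t)), ∀ ζ : UnitAddTorus d → ℝ,
      IsLogLipschitz δ ζ → ζ 0 = 0 → ∫ x, ρs x * ζ x = krLogDist δ ρs → -∫ x, ζ x * fl σ x ≤ m σ) :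
    krLogDist δ ρs - krLogDist δ ρt ≤ ∫ σ in Ioc s t, m σ := by
  obtain ⟨ζ, hζ, hζ0, hopt⟩ := exists_isLogLipschitz_integral_eq_krLogDist hδ hρs hs0
  have hζc := hζ.continuous hδ
  obtain ⟨Cζ, hCζ'⟩ := isCompact_univ.exists_bound_of_continuousOn hζc.continuousOn
  have hCζ : ∀ x, ‖ζ x‖ ≤ Cζ := fun x => hCζ' x (mem_univ x)
  -- the joint integrand `ζ x fl σ x` on `(s,t] × T^d`
  have hHm : AEStronglyMeasurable (uncurry fun σ x => ζ x * fl σ x)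
      (((volume : Measure ℝ).restrict (Ioc s t)).prod volume) :=
    ((hζc.comp continuous_snd).aestronglyMeasurable).mul hflm
  have hbd' : ∀ᵐ p ∂(((volume : Measure ℝ).restrict (Ioc s t)).prod (volume : Measure (UnitAddTorus d))),
      ‖fl p.1 p.2‖ ≤ bound p.1 :=
    ((Measure.quasiMeasurePreserving_fst (μ := (volume : Measure ℝ).restrict (Ioc s t))
      (ν := (volume : Measure (UnitAddTorus d)))).ae hbd).mono fun p hp => hp p.2
  have hHi : Integrable (uncurry fun σ x => ζ x * fl σ x)
      (((volume : Measure ℝ).restrict (Ioc s t)).prod volume) := by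
    refine ((hbi.mul_const Cζ).comp_fst (volume : Measure (UnitAddTorus d))).mono' hHm ?_
    filter_upwards [hbd'] with p hp
    simp only [uncurry]
    rw [norm_mul, mul_comm]
    exact mul_le_mul hp (hCζ _) (norm_nonneg _) ((norm_nonneg _).trans hp)
  -- `krLogDist δ ρₜ ≥ ∫ ρₜ ζ`
  have h1 : ∫ x, ρt x * ζ x ≤ krLogDist δ ρt := integral_mul_le_krLogDist hδ hρt ht0 hζ
  -- `∫ ρₛ ζ - ∫ ρₜ ζ = -∫_{(s,t]} ∫ ζ fl(σ)`
  have h2 : (∫ x, ρs x * ζ x) - ∫ x, ρt x * ζ x = -∫ σ in Ioc s t, ∫ x, ζ x * fl σ x := by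
    rw [integral_integral_swap hHi, ← integral_neg,
      ← integral_sub (hζ.integrable_mul hδ hρs) (hζ.integrable_mul hδ hρt)]
    refine integral_congr_ae (Eventually.of_forall fun x => ?_)
    show ρs x * ζ x - ρt x * ζ x = -∫ σ in Ioc s t, ζ x * fl σ x
    rw [integral_const_mul, ← hprim x]
    ring
  -- integrate the slice bound
  have h3 : -∫ σ in Ioc s t, ∫ x, ζ x * fl σ x ≤ ∫ σ in Ioc s t, m σ := by
    rw [← integral_neg]
    refine integral_mono_ae hHi.integral_prod_left.neg hmi ?_
    filter_upwards [hslice] with σ hσ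
    exact hσ ζ hζ hζ0 hopt
  linarith

/-! ## Sup-norm continuity of the dual distance -/

/-- **The dual distance is Lipschitz for the sup norm**: for mean-zero integrable `ρ, ρ'` with
`|ρ - ρ'| ≤ ε₀` pointwise, `krLogDist δ ρ ≤ krLogDist δ ρ' + log(1 + 1/(2δ)) ε₀` (test `ρ` against
`ζ - ζ 0`, whose modulus is `≤ log(1+1/(2δ))`). [folklore] -/
theorem krLogDist_le_krLogDist_add_of_abs_sub_le {δ : ℝ} (hδ : 0 < δ) {ρ ρ' : UnitAddTorus d → ℝ}
    (hρ : Integrable ρ volume) (h0 : ∫ x, ρ x = 0) (hρ' : Integrable ρ' volume) (h0' : ∫ x, ρ' x = 0)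
    {ε₀ : ℝ} (h : ∀ x, |ρ x - ρ' x| ≤ ε₀) :
    krLogDist δ ρ ≤ krLogDist δ ρ' + Real.log (1 + 1 / (2 * δ)) * ε₀ := by
  haveI : Nonempty {ζ : UnitAddTorus d → ℝ // IsLogLipschitz δ ζ} := nonempty_isLogLipschitz hδ
  refine ciSup_le fun ζ => ?_
  set Z : UnitAddTorus d → ℝ := fun x => (ζ : UnitAddTorus d → ℝ) x - (ζ : UnitAddTorus d → ℝ) 0 with hZ
  have hZ' : IsLogLipschitz δ Z := ζ.2.sub_const _
  have hZb : ∀ x, |Z x| ≤ Real.log (1 + 1 / (2 * δ)) := fun x => ζ.2.abs_sub_le_log hδ x 0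
  have hiρ := ζ.2.integrable_mul hδ hρ
  have hiZρ := hZ'.integrable_mul hδ hρ
  have hiZρ' := hZ'.integrable_mul hδ hρ'
  -- `∫ ρ ζ = ∫ ρ Z` (mean zero)
  have e1 : ∫ x, ρ x * (ζ : UnitAddTorus d → ℝ) x = ∫ x, ρ x * Z x := by
    simp only [hZ, mul_sub]
    rw [integral_sub hiρ (hρ.mul_const _), integral_mul_const, h0, zero_mul, sub_zero]
  rw [e1]
  -- `∫ ρ Z = ∫ ρ' Z + ∫ (ρ - ρ') Z`
  have hidiff : Integrable (fun x => (ρ x - ρ' x) * Z x) volume :=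
    (hiZρ.sub hiZρ').congr (Eventually.of_forall fun x => by simp [sub_mul])
  have e2 : ∫ x, ρ x * Z x = (∫ x, ρ' x * Z x) + ∫ x, (ρ x - ρ' x) * Z x := by
    rw [← integral_add hiZρ' hidiff]
    refine integral_congr_ae (Eventually.of_forall fun x => ?_)
    ring
  rw [e2]
  refine add_le_add (integral_mul_le_krLogDist hδ hρ' h0' hZ') ?_
  have hb : Integrable (fun _ : UnitAddTorus d => Real.log (1 + 1 / (2 * δ)) * ε₀) volume := integrable_const _
  calc ∫ x, (ρ x - ρ' x) * Z x ≤ ∫ _x : UnitAddTorus d, Real.log (1 + 1 / (2 * δ)) * ε₀ := by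
        refine integral_mono hidiff hb fun x => ?_
        calc (ρ x - ρ' x) * Z x ≤ |(ρ x - ρ' x) * Z x| := le_abs_self _
          _ = |ρ x - ρ' x| * |Z x| := abs_mul _ _
          _ ≤ ε₀ * Real.log (1 + 1 / (2 * δ)) :=
              mul_le_mul (h x) (hZb x) (abs_nonneg _) ((abs_nonneg _).trans (h x))
          _ = Real.log (1 + 1 / (2 * δ)) * ε₀ := mul_comm _ _
    _ = Real.log (1 + 1 / (2 * δ)) * ε₀ := by simp

/-- Symmetric form: `|krLogDist δ ρ - krLogDist δ ρ'| ≤ log(1 + 1/(2δ)) ε₀`. [folklore] -/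
theorem abs_krLogDist_sub_krLogDist_le {δ : ℝ} (hδ : 0 < δ) {ρ ρ' : UnitAddTorus d → ℝ}
    (hρ : Integrable ρ volume) (h0 : ∫ x, ρ x = 0) (hρ' : Integrable ρ' volume) (h0' : ∫ x, ρ' x = 0)
    {ε₀ : ℝ} (h : ∀ x, |ρ x - ρ' x| ≤ ε₀) :
    |krLogDist δ ρ - krLogDist δ ρ'| ≤ Real.log (1 + 1 / (2 * δ)) * ε₀ := by
  rw [abs_sub_le_iff]
  constructor
  · linarith [krLogDist_le_krLogDist_add_of_abs_sub_le hδ hρ h0 hρ' h0' h]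
  · linarith [krLogDist_le_krLogDist_add_of_abs_sub_le hδ hρ' h0' hρ h0 fun x => by rw [abs_sub_comm]; exact h x]

/-! ## Good partitions -/

/-- A subinterval of positive length of `(0, T)` meets any set of full measure in `(0, T)`. [folklore] -/
theorem exists_mem_of_ae_mem {S : Set ℝ} {T : ℝ} (hS : ∀ᵐ t ∂((volume : Measure ℝ).restrict (Ioo 0 T)), t ∈ S)
    {a b : ℝ} (ha : 0 ≤ a) (hab : a < b) (hb : b ≤ T) : ∃ q ∈ S, q ∈ Ioo a b := by
  by_contra hc
  push Not at hc
  have hsub : Ioo a b ⊆ {t | t ∉ S} ∩ Ioo 0 T := fun q hq =>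
    ⟨fun hqS => (hc q hqS) hq, ⟨ha.trans_lt hq.1, hq.2.trans_le hb⟩⟩
  have h0 : (volume : Measure ℝ) ({t | t ∉ S} ∩ Ioo 0 T) = 0 := by
    have := ae_iff.1 hS
    rwa [Measure.restrict_apply' measurableSet_Ioo] at this
  have : (volume : Measure ℝ) (Ioo a b) = 0 := measure_mono_null hsub h0
  rw [Real.volume_Ioo] at this
  have : ENNReal.ofReal (b - a) ≠ 0 := by simpa using hab
  exact this ‹_›

/-- **Good chains.** Let `S` have full measure in `(0, T)`, `s₁ < τ` two of its points with
`τ < T`, and `h > 0`. Then there is a finite chain `s₁ = p 0 < p 1 < ⋯ < p J = τ` of points of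
`S` with gaps `≤ h`. [folklore] -/
theorem exists_chain_mem {S : Set ℝ} {T : ℝ} (hS : ∀ᵐ t ∂((volume : Measure ℝ).restrict (Ioo 0 T)), t ∈ S)
    {s₁ τ : ℝ} (hs₁ : s₁ ∈ S) (hs₁0 : 0 < s₁) (hτ : τ ∈ S) (hsτ : s₁ < τ) (hτT : τ < T)
    {h : ℝ} (hh : 0 < h) :
    ∃ (J : ℕ) (p : ℕ → ℝ), 0 < J ∧ p 0 = s₁ ∧ p J = τ ∧ (∀ j, j < J → p j < p (j + 1)) ∧
      (∀ j, j ≤ J → p j ∈ S) ∧ (∀ j, j < J → p (j + 1) - p j ≤ h) := by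
  -- half-mesh and number of cells
  set h' : ℝ := h / 2 with hh'
  have hh'0 : 0 < h' := by positivity
  set J : ℕ := ⌈(τ - s₁) / h'⌉₊ with hJ
  have hJ1 : 0 < J := Nat.ceil_pos.2 (div_pos (by linarith) hh'0)
  have hJle : τ - s₁ ≤ J * h' := by
    have := Nat.le_ceil ((τ - s₁) / h')
    rw [← hJ] at this
    rwa [div_le_iff₀ hh'0] at this
  have hJlt : ((J : ℝ) - 1) * h' < τ - s₁ := by
    have := Nat.ceil_lt_add_one (div_nonneg (by linarith : (0 : ℝ) ≤ τ - s₁) hh'0.le)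
    rw [← hJ] at this
    have h2 : (J : ℝ) - 1 < (τ - s₁) / h' := by linarith
    rwa [lt_div_iff₀ hh'0] at h2
  -- interior points `q j ∈ S ∩ (s₁ + (j-1) h', s₁ + j h')` for `1 ≤ j ≤ J - 1`
  have hq : ∀ j : ℕ, 1 ≤ j → j + 1 ≤ J → ∃ q ∈ S, q ∈ Ioo (s₁ + (j - 1) * h') (s₁ + j * h') := by
    intro j hj1 hjJ
    have hj1' : (1 : ℝ) ≤ j := by exact_mod_cast hj1
    have hjJ' : (j : ℝ) + 1 ≤ J := by exact_mod_cast hjJ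
    refine exists_mem_of_ae_mem hS ?_ ?_ ?_
    · nlinarith [hs₁0.le]
    · nlinarith
    · have : (j : ℝ) * h' ≤ ((J : ℝ) - 1) * h' := mul_le_mul_of_nonneg_right (by linarith) hh'0.le
      linarith
  choose! q hqS hqI using hq
  -- the chain
  set p : ℕ → ℝ := fun j => if j = 0 then s₁ else if j < J then q j else τ with hp
  have hp0 : p 0 = s₁ := by simp [hp]
  have hpJ : p J = τ := by simp [hp, hJ1.ne']
  have hpmid : ∀ j, 1 ≤ j → j < J → p j = q j := fun j hj1 hjJ => by
    simp [hp, Nat.one_le_iff_ne_zero.1 hj1, hjJ]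
  have hpend : ∀ j, J ≤ j → p j = τ := fun j hj => by
    have h0 : j ≠ 0 := by omega
    simp [hp, h0, not_lt.2 hj]
  refine ⟨J, p, hJ1, hp0, hpJ, ?_, ?_, ?_⟩
  · -- strictly increasing
    intro j hj
    by_cases hj0 : j = 0
    · subst hj0
      rw [hp0]
      by_cases h1J : 1 < J
      · rw [hpmid 1 le_rfl h1J]
        have := (hqI 1 le_rfl h1J).1
        simpa using this
      · rw [hpend 1 (by omega)]; exact hsτ
    · have hj1 : 1 ≤ j := Nat.one_le_iff_ne_zero.2 hj0
      rw [hpmid j hj1 hj]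
      have h1 := (hqI j hj1 (by omega)).2
      by_cases hj' : j + 1 < J
      · rw [hpmid (j + 1) (by omega) hj']
        have h2 := (hqI (j + 1) (by omega) (by omega)).1
        push_cast at h2
        linarith
      · rw [hpend (j + 1) (by omega)]
        have hjJ' : (j : ℝ) + 1 ≤ J := by exact_mod_cast (show j + 1 ≤ J by omega)
        have : (j : ℝ) * h' ≤ ((J : ℝ) - 1) * h' := mul_le_mul_of_nonneg_right (by linarith) hh'0.le
        linarith
  · -- points of `S`
    intro j hj
    by_cases hj0 : j = 0
    · subst hj0; rw [hp0]; exact hs₁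
    · by_cases hj' : j < J
      · rw [hpmid j (Nat.one_le_iff_ne_zero.2 hj0) hj']
        exact hqS j (Nat.one_le_iff_ne_zero.2 hj0) (by omega)
      · rw [hpend j (not_lt.1 hj')]; exact hτ
  · -- gaps
    intro j hj
    by_cases hj0 : j = 0
    · subst hj0
      rw [hp0]
      by_cases h1J : 1 < J
      · rw [hpmid 1 le_rfl h1J]
        have := (hqI 1 le_rfl h1J).2
        simp only [Nat.cast_one, one_mul] at this
        linarith
      · rw [hpend 1 (by omega)]
        have : (J : ℝ) = 1 := by exact_mod_cast (show J = 1 by omega)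
        rw [this] at hJle
        linarith
    · have hj1 : 1 ≤ j := Nat.one_le_iff_ne_zero.2 hj0
      rw [hpmid j hj1 hj]
      have h1 := (hqI j hj1 (by omega)).1
      by_cases hj' : j + 1 < J
      · rw [hpmid (j + 1) (by omega) hj']
        have h2 := (hqI (j + 1) (by omega) (by omega)).2
        push_cast at h2
        linarith
      · rw [hpend (j + 1) (by omega)]
        have : (J : ℝ) = j + 1 := by exact_mod_cast (show J = j + 1 by omega)
        rw [this] at hJle
        linarith

/-! ## Telescoping -/

/-- **Telescoping increments along a chain.** If `Φ (p j) - Φ (p (j+1)) ≤ ∫_{(p j, p (j+1)]} m +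
c (p (j+1) - p j)` for all `j < J` along an increasing chain and `m` is integrable on
`(p 0, p J]`, then `Φ (p 0) - Φ (p J) ≤ ∫_{(p 0, p J]} m + c (p J - p 0)`. [folklore] -/
theorem sub_le_integral_add_of_chain {Φ : ℝ → ℝ} {m : ℝ → ℝ} {c : ℝ} {J : ℕ} {p : ℕ → ℝ}
    (hmono : ∀ j, j < J → p j ≤ p (j + 1)) (hmi : IntegrableOn m (Ioc (p 0) (p J)))
    (hinc : ∀ j, j < J → Φ (p j) - Φ (p (j + 1)) ≤ (∫ σ in Ioc (p j) (p (j + 1)), m σ) + c * (p (j + 1) - p j)) :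
    Φ (p 0) - Φ (p J) ≤ (∫ σ in Ioc (p 0) (p J), m σ) + c * (p J - p 0) := by
  have hmono' : ∀ i j, i ≤ j → j ≤ J → p i ≤ p j := by
    intro i j hij hjJ
    induction j with
    | zero => simp [Nat.le_zero.1 hij]
    | succ j ih =>
      rcases Nat.lt_or_ge i (j + 1) with hlt | hge
      · exact (ih (Nat.lt_succ_iff.1 hlt) (Nat.le_of_succ_le hjJ)).trans (hmono j (Nat.lt_of_succ_le hjJ))
      · rw [le_antisymm hij hge]
  -- telescoping sums
  have e1 : Φ (p 0) - Φ (p J) = ∑ j ∈ Finset.range J, (Φ (p j) - Φ (p (j + 1))) :=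
    (Finset.sum_range_sub' (fun j => Φ (p j)) J).symm
  have e2 : c * (p J - p 0) = ∑ j ∈ Finset.range J, c * (p (j + 1) - p j) := by
    rw [← Finset.mul_sum, Finset.sum_range_sub]
  have e3 : ∫ σ in Ioc (p 0) (p J), m σ = ∑ j ∈ Finset.range J, ∫ σ in Ioc (p j) (p (j + 1)), m σ := by
    have hint : ∀ k < J, IntervalIntegrable m volume (p k) (p (k + 1)) := fun k hk => by
      rw [intervalIntegrable_iff_integrableOn_Ioc_of_le (hmono k hk)]
      exact hmi.mono_set (Ioc_subset_Ioc (hmono' 0 k (Nat.zero_le _) hk.le)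
        (hmono' (k + 1) J (Nat.succ_le_of_lt hk) le_rfl))
    have h := intervalIntegral.sum_integral_adjacent_intervals hint
    rw [intervalIntegral.integral_of_le (hmono' 0 J (Nat.zero_le _) le_rfl)] at h
    rw [← h]
    refine Finset.sum_congr rfl fun j hj => ?_
    rw [intervalIntegral.integral_of_le (hmono j (Finset.mem_range.1 hj))]
  rw [e1, e2, e3, ← Finset.sum_add_distrib]
  exact Finset.sum_le_sum fun j hj => hinc j (Finset.mem_range.1 hj)

end Literature.Analysis.FluidPDE
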